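import Summits.QuantumFields.YangMills.Theorems.AllWindowsColdBoxBoxHighLineRestBlockBoxLap
import Summits.QuantumFields.YangMills.Theorems.AllWindowsColdBoxBoxKernelWallDecay

/-!
# LINE-20 U1b/U1c — the plaquette source through the rest Green function: `|(K^rel)⁻¹ λ_p| ≲ (1+d)⁻³` (hypothesis `a₁` of `schur_jaffard_gradient_decay`)

For the instantiation of ✓`schur_jaffard_gradient_decay` / `schur_jaffard_dipole_decay` (`…AllWindowsColdBoxSchurJaffardGradient`, ⟨stmt-QuantumFields-24336⟩
U1b `LandauKernelGradDecay` / U1c `LandauDipoleDecay`) with `KI = restInv H` (✓`…BoxHighLineRestBlockBoxLap`, w2): the rest part of the plaquette source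
`λ_p = landauCoeff H p` (`p = (x, j, k)`) is `[δ_{(x,j)} − δ_{(x+e_k,j)}] + [δ_{(x+e_j,k)} − δ_{(x,k)}]` restricted to rest links — on each direction block
a NEIGHBOUR DIFFERENCE, or (when the partner edge is a skin/pinned edge) a SINGLE delta ADJACENT TO A DIRICHLET FACE of that block, or nothing.  Hence
* `sum_restInv_mul_ite_eq` / `_eq_zero`, `restInv_ofBox` (with ✓`landauCoeff_apply` of `…HodgeRows`) — the `restInv`-row against the indicator of one edge;
* `pair_decay` — `|Σ_{r'} KI(r,r')([r' = (y,μ)] − [r' = (y+e_ν,μ)])|·(1 + |r_κ − y_κ|)³ ≤ C` (✓`boxLap_inv_grad_snd_decay`, ✓`boxLap_inv_wall_decay`);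
* **`restInv_mulVec_landauCoeff_decay`** — `|(restInv H *ᵥ (λ_p|rest))(r)|·(1 + |r_κ − x_κ|)³ ≤ C` for every `H ≥ 1`, plaquette `p`, rest link `r`
  and coordinate `κ` (the input `a₁`, log-free, uniform in `H`).
No definitions; standard axioms.

HONEST LABEL: helper toward the OPEN stub U1 `stub_landauKernelPackage` of a critic-stamped DRAFT line on the R2ξ″ crux; no stub, crux, rung or summit is
proved here; the Yang–Mills mass gap is NOT proved by this file.
-/

set_option autoImplicit false

noncomputable section

namespace Summit.QuantumFields.YangMills.Theorems.AllWindowsColdBoxBoxHighLine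

open Finset Matrix
open Literature.Probability.LatticeModels (Site)
open Literature.MathematicalPhysics.QuantumFieldTheory
open Literature.MathematicalPhysics.QuantumFieldTheory.LatticeMaxwell
open Literature.MathematicalPhysics.QuantumFieldTheory.AxialGauge
open Summit.QuantumFields.YangMills.Theorems.WeakCouplingRates
open Summit.QuantumFields.YangMills.Theorems.AllWindowsColdBox.BoxKernel
open RestBlock

namespace PlaqSource

variable {H : ℕ}

/-! ## The `restInv`-row against the indicator of one edge -/

/-- A rest link is determined by its edge. -/
theorem rest_ext {r r' : Rest H} (h : r.1.1.1 = r'.1.1.1) : r = r' :=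
  Subtype.ext (Subtype.ext (Subtype.ext h))

/-- If the edge `E` is the rest link `r₀`, the row of `restInv` against `[· = E]` is the entry at `r₀`. -/
theorem sum_restInv_mul_ite_eq (r r₀ : Rest H) (E : Literature.MathematicalPhysics.QuantumLattice.ZdEdge 4) (hE : r₀.1.1.1 = E) :
    ∑ r' : Rest H, restInv H r r' * (if r'.1.1.1 = E then (1 : ℝ) else 0) = restInv H r r₀ := by
  rw [Finset.sum_eq_single r₀]
  · rw [if_pos hE, mul_one]
  · intro r' _ hne
    rw [if_neg, mul_zero]
    intro h
    exact hne (rest_ext (h.trans hE.symm))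
  · intro h; exact absurd (Finset.mem_univ _) h

/-- If no rest link has the edge `E`, the row of `restInv` against `[· = E]` vanishes. -/
theorem sum_restInv_mul_ite_eq_zero (r : Rest H) (E : Literature.MathematicalPhysics.QuantumLattice.ZdEdge 4) (hE : ∀ r' : Rest H, r'.1.1.1 ≠ E) :
    ∑ r' : Rest H, restInv H r r' * (if r'.1.1.1 = E then (1 : ℝ) else 0) = 0 :=
  Finset.sum_eq_zero fun r' _ => by rw [if_neg (hE r'), mul_zero]

/-- If the row link has a different direction than `E`, the row of `restInv` against `[· = E]` vanishes (block diagonality). -/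
theorem sum_restInv_mul_ite_eq_zero_of_ne (r : Rest H) (E : Literature.MathematicalPhysics.QuantumLattice.ZdEdge 4) (hdir : r.1.1.1.2 ≠ E.2) :
    ∑ r' : Rest H, restInv H r r' * (if r'.1.1.1 = E then (1 : ℝ) else 0) = 0 :=
  Finset.sum_eq_zero fun r' _ => by
    by_cases h : r'.1.1.1 = E
    · rw [restInv_apply_of_ne r r' (by rw [h]; exact hdir), zero_mul]
    · rw [if_neg h, mul_zero]

/-- A rest link with edge `(y, μ)` exists iff `(y, μ)` is a rest link in coordinates (for `H ≥ 1`). -/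
theorem isRest_of_edge_eq (r₀ : Rest H) {y : Site 4} {μ : Fin 4} (h : r₀.1.1.1 = (y, μ)) : IsRest H y μ := by
  have := isRest_rest r₀
  rw [h] at this
  exact this

/-- The rest link of the box point `toBox μ y h` has edge `(y, μ)`. -/
theorem ofBox_toBox_edge (μ : Fin 4) (y : Site 4) (h : IsRest H y μ) : (ofBox μ (toBox μ y h)).1.1.1 = (y, μ) := by
  change (coords (toBox μ y h), μ) = (y, μ)
  rw [coords_toBox]

/-- `restInv` between a link of direction `μ` and the link of a box point of the `μ`-block is the box Green function. -/
theorem restInv_ofBox {μ : Fin 4} (r : Rest H) (hdir : r.1.1.1.2 = μ) (s : Box 4 (2 * H) (univ.erase μ)) :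
    restInv H r (ofBox μ s) = (boxLap (2 * H) (univ.erase μ))⁻¹ (toBox μ r.1.1.1.1 (hdir ▸ isRest_rest r)) s := by
  rw [restInv_apply_of_eq μ r (ofBox μ s) hdir rfl]
  exact congrArg _ (toBox_coords μ s _)

/-! ## Which partner edges are rest links -/

/-- If `(y, μ)` is a rest link but `(y + e_ν, μ)` (`ν ≠ μ`) is not, then `y_ν = 2H − 1` (the link is adjacent to the TOP Dirichlet face `ν`). -/
theorem eq_top_of_isRest_of_not {y : Site 4} {μ ν : Fin 4} (hne : μ ≠ ν) (h1 : IsRest H y μ) (h2 : ¬ IsRest H (y + Pi.single ν 1) μ) :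
    y ν = 2 * (H : ℤ) - 1 := by
  by_contra hc
  have hyν := h1.1 ν (Ne.symm hne)
  apply h2
  refine ⟨fun ν' hν' => ?_, ?_, ?_⟩
  · by_cases hν'ν : ν' = ν
    · subst hν'ν; simp only [Pi.add_apply, Pi.single_eq_same]; omega
    · have := h1.1 ν' hν'; simp only [Pi.add_apply, Pi.single_eq_of_ne hν'ν, add_zero]; exact this
  · have := h1.2.1; simp only [Pi.add_apply, Pi.single_eq_of_ne hne, add_zero]; exact this
  · have := h1.2.2; simp only [Pi.add_apply, Pi.single_eq_of_ne hne, add_zero]; exact this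

/-- If `(y + e_ν, μ)` (`ν ≠ μ`) is a rest link but `(y, μ)` is not, then `y_ν = 0` (the link `(y+e_ν, μ)` is adjacent to the BOTTOM Dirichlet face `ν`). -/
theorem eq_bottom_of_not_of_isRest {y : Site 4} {μ ν : Fin 4} (hne : μ ≠ ν) (h1 : ¬ IsRest H y μ) (h2 : IsRest H (y + Pi.single ν 1) μ) :
    y ν = 0 := by
  by_contra hc
  have hyν := h2.1 ν (Ne.symm hne)
  simp only [Pi.add_apply, Pi.single_eq_same] at hyν
  apply h1
  refine ⟨fun ν' hν' => ?_, ?_, ?_⟩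
  · by_cases hν'ν : ν' = ν
    · subst hν'ν; omega
    · have := h2.1 ν' hν'; simp only [Pi.add_apply, Pi.single_eq_of_ne hν'ν, add_zero] at this; exact this
  · have := h2.2.1; simp only [Pi.add_apply, Pi.single_eq_of_ne hne, add_zero] at this; exact this
  · have := h2.2.2; simp only [Pi.add_apply, Pi.single_eq_of_ne hne, add_zero] at this; exact this

/-- The `ν`-coordinate of the box point of a rest link, as a natural number cast to `ℤ`. -/
theorem toBox_coord_eq (μ : Fin 4) (y : Site 4) (h : IsRest H y μ) (ν : Fin 4) : (((toBox μ y h).1 ν : ℕ) : ℤ) = y ν := by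
  have := congrFun (coords_toBox μ y h) ν
  simpa [coords] using this

/-- Re-anchoring a `(1+|a−b|)³` weight to a point at distance `≤ 1`. -/
theorem reanchor_three {X a b b' C : ℝ} (hb : |b' - b| ≤ 1) (h : |X| * (1 + |a - b'|) ^ 3 ≤ C) :
    |X| * (1 + |a - b|) ^ 3 ≤ 8 * C := by
  have h1 : 1 + |a - b| ≤ 2 * (1 + |a - b'|) := by
    have : |a - b| ≤ |a - b'| + |b' - b| := abs_sub_le a b' b
    linarith [abs_nonneg (a - b')]
  have h2 : (1 + |a - b|) ^ 3 ≤ 8 * (1 + |a - b'|) ^ 3 := by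
    calc (1 + |a - b|) ^ 3 ≤ (2 * (1 + |a - b'|)) ^ 3 := pow_le_pow_left₀ (by positivity) h1 3
      _ = 8 * (1 + |a - b'|) ^ 3 := by ring
  calc |X| * (1 + |a - b|) ^ 3 ≤ |X| * (8 * (1 + |a - b'|) ^ 3) := mul_le_mul_of_nonneg_left h2 (abs_nonneg X)
    _ = 8 * (|X| * (1 + |a - b'|) ^ 3) := by ring
    _ ≤ 8 * C := mul_le_mul_of_nonneg_left h (by norm_num)

/-- The base point of the shifted edge is at distance `≤ 1` in every coordinate. -/
theorem abs_cast_add_single_sub_le (y : Site 4) (ν κ : Fin 4) :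
    |((((y + Pi.single ν 1 : Site 4) κ : ℤ)) : ℝ) - ((y κ : ℤ) : ℝ)| ≤ 1 := by
  rw [Pi.add_apply]
  by_cases h : κ = ν
  · subst h; simp
  · simp [Pi.single_eq_of_ne h]

/-! ## The pair estimate -/

/-- **Pair estimate**: for a rest link `r`, a base point `y` and directions `μ ≠ ν`,
`|Σ_{r'} KI(r,r')·([r' = (y,μ)] − [r' = (y+e_ν,μ)])|·(1 + |r_κ − y_κ|)³ ≤ C` — a neighbour difference of the `μ`-block Green function when both
edges are rest links (✓`boxLap_inv_grad_snd_decay`), a wall-adjacent single when exactly one is (✓`boxLap_inv_wall_decay`), zero otherwise. -/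
theorem pair_decay : ∃ C : ℝ, 0 ≤ C ∧ ∀ (H : ℕ) [NeZero H] (r : Rest H) (y : Site 4) (μ ν κ : Fin 4), μ ≠ ν →
    |(∑ r' : Rest H, restInv H r r' * (if r'.1.1.1 = (y, μ) then (1 : ℝ) else 0)) -
        (∑ r' : Rest H, restInv H r r' * (if r'.1.1.1 = (y + Pi.single ν 1, μ) then (1 : ℝ) else 0))| *
      (1 + |((r.1.1.1.1 κ : ℤ) : ℝ) - ((y κ : ℤ) : ℝ)|) ^ 3 ≤ C := by
  obtain ⟨C₁, hC₁0, hC₁⟩ := boxLap_inv_grad_snd_decay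
  obtain ⟨C₂, hC₂0, hC₂⟩ := boxLap_inv_wall_decay
  refine ⟨C₁ + 8 * C₂, by positivity, ?_⟩
  intro H _ r y μ ν κ hμν
  haveI : NeZero (2 * H) := ⟨by have := NeZero.ne H; omega⟩
  have hw0 : 0 ≤ (1 + |((r.1.1.1.1 κ : ℤ) : ℝ) - ((y κ : ℤ) : ℝ)|) ^ 3 := by positivity
  by_cases hdir : r.1.1.1.2 = μ
  · -- the row link lies in the `μ`-block
    have hrκ : ((((toBox μ r.1.1.1.1 (hdir ▸ isRest_rest r)).1 κ : ℕ)) : ℝ) = ((r.1.1.1.1 κ : ℤ) : ℝ) :=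
      toBox_apply_cast μ _ _ κ
    have hνD : ν ∈ (Finset.univ.erase μ : Finset (Fin 4)) := Finset.mem_erase.2 ⟨Ne.symm hμν, Finset.mem_univ _⟩
    by_cases h1 : IsRest H y μ <;> by_cases h2 : IsRest H (y + Pi.single ν 1) μ
    · -- both rest: a neighbour difference
      rw [sum_restInv_mul_ite_eq r _ _ (ofBox_toBox_edge μ y h1), sum_restInv_mul_ite_eq r _ _ (ofBox_toBox_edge μ _ h2),
        restInv_ofBox r hdir, restInv_ofBox r hdir]
      have hst : coords (toBox μ (y + Pi.single ν 1) h2) = coords (toBox μ y h1) + Pi.single ν 1 := by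
        rw [coords_toBox, coords_toBox]
      have h := hC₁ (2 * H) (Finset.univ.erase μ) (erase_nonempty μ) ν κ (toBox μ r.1.1.1.1 (hdir ▸ isRest_rest r))
        (toBox μ y h1) (toBox μ (y + Pi.single ν 1) h2) hst
      rw [hrκ, toBox_apply_cast, abs_sub_comm ((boxLap (2 * H) (univ.erase μ))⁻¹ _ _)] at h
      linarith [mul_nonneg hC₂0 hw0]
    · -- only `(y, μ)` rest: top-adjacent single
      rw [sum_restInv_mul_ite_eq r _ _ (ofBox_toBox_edge μ y h1),
        sum_restInv_mul_ite_eq_zero r _ (fun r' hr' => h2 (isRest_of_edge_eq r' hr')), sub_zero, restInv_ofBox r hdir]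
      have htop : (((toBox μ y h1).1 ν : ℕ)) + 1 = 2 * H := by
        have := toBox_coord_eq μ y h1 ν
        have hy := eq_top_of_isRest_of_not hμν h1 h2
        omega
      have h := hC₂ (2 * H) (Finset.univ.erase μ) (erase_nonempty μ) ν κ hνD (toBox μ r.1.1.1.1 (hdir ▸ isRest_rest r))
        (toBox μ y h1) (Or.inl htop)
      rw [hrκ, toBox_apply_cast] at h
      linarith [mul_nonneg hC₂0 hw0]
    · -- only `(y + e_ν, μ)` rest: bottom-adjacent single
      rw [sum_restInv_mul_ite_eq_zero r _ (fun r' hr' => h1 (isRest_of_edge_eq r' hr')),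
        sum_restInv_mul_ite_eq r _ _ (ofBox_toBox_edge μ _ h2), zero_sub, abs_neg, restInv_ofBox r hdir]
      have hbot : (((toBox μ (y + Pi.single ν 1) h2).1 ν : ℕ)) = 1 := by
        have := toBox_coord_eq μ (y + Pi.single ν 1) h2 ν
        have hy := eq_bottom_of_not_of_isRest hμν h1 h2
        simp only [Pi.add_apply, Pi.single_eq_same, hy, zero_add] at this
        omega
      have h := hC₂ (2 * H) (Finset.univ.erase μ) (erase_nonempty μ) ν κ hνD (toBox μ r.1.1.1.1 (hdir ▸ isRest_rest r))
        (toBox μ (y + Pi.single ν 1) h2) (Or.inr hbot)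
      rw [hrκ, toBox_apply_cast] at h
      have h' := reanchor_three (abs_cast_add_single_sub_le y ν κ) h
      linarith [mul_nonneg hC₁0 hw0]
    · -- neither: zero
      rw [sum_restInv_mul_ite_eq_zero r _ (fun r' hr' => h1 (isRest_of_edge_eq r' hr')),
        sum_restInv_mul_ite_eq_zero r _ (fun r' hr' => h2 (isRest_of_edge_eq r' hr')), sub_zero, abs_zero, zero_mul]
      positivity
  · -- different direction: both rows vanish
    rw [sum_restInv_mul_ite_eq_zero_of_ne r _ hdir, sum_restInv_mul_ite_eq_zero_of_ne r _ hdir, sub_zero, abs_zero, zero_mul]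
    positivity

/-! ## The estimate `a₁` -/

/-- `|A − B|·w ≤ 2C` from `|A|·w ≤ C`, `|B|·w ≤ C`. -/
theorem abs_sub_mul_le_two {A B w C : ℝ} (hw : 0 ≤ w) (h1 : |A| * w ≤ C) (h2 : |B| * w ≤ C) : |A - B| * w ≤ 2 * C := by
  have := abs_sub A B
  nlinarith [abs_nonneg A, abs_nonneg B]

/-- **`a₁` for the plaquette source**: `|(restInv H *ᵥ (r' ↦ landauCoeff H p r'))(r)|·(1 + |r_κ − x_κ|)³ ≤ C` for every `H ≥ 1`, plaquette `p = (x,j,k)`,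
rest link `r` and coordinate `κ` — uniformly, without logarithm. -/
theorem restInv_mulVec_landauCoeff_decay : ∃ C : ℝ, 0 ≤ C ∧ ∀ (H : ℕ) [NeZero H] (p : Plaq 4) (r : Rest H) (κ : Fin 4),
    |(restInv H *ᵥ fun r' : Rest H => landauCoeff H p r'.1) r| * (1 + |((r.1.1.1.1 κ : ℤ) : ℝ) - ((p.1 κ : ℤ) : ℝ)|) ^ 3 ≤ C := by
  obtain ⟨C, hC0, hC⟩ := pair_decay
  refine ⟨2 * C, by positivity, ?_⟩
  rintro H _ ⟨x, j, k⟩ r κ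
  have hw0 : 0 ≤ (1 + |((r.1.1.1.1 κ : ℤ) : ℝ) - ((x κ : ℤ) : ℝ)|) ^ 3 := by positivity
  change |(restInv H *ᵥ fun r' : Rest H => landauCoeff H (x, j, k) r'.1) r| * (1 + |((r.1.1.1.1 κ : ℤ) : ℝ) - ((x κ : ℤ) : ℝ)|) ^ 3 ≤ 2 * C
  by_cases hjk : j = k
  · -- degenerate plaquette: the source vanishes
    subst hjk
    have h0 : (fun r' : Rest H => landauCoeff H (x, j, j) r'.1) = 0 := by
      funext r'
      simp only [landauCoeff_apply, coeffAux, Pi.zero_apply]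
      ring
    rw [h0, Matrix.mulVec_zero, Pi.zero_apply, abs_zero, zero_mul]
    positivity
  · -- expand the source into its two pairs of indicator vectors
    have hexp : (restInv H *ᵥ fun r' : Rest H => landauCoeff H (x, j, k) r'.1) r =
        ((∑ r' : Rest H, restInv H r r' * (if r'.1.1.1 = (x, j) then (1 : ℝ) else 0)) -
          (∑ r' : Rest H, restInv H r r' * (if r'.1.1.1 = (x + Pi.single k 1, j) then (1 : ℝ) else 0))) -
        ((∑ r' : Rest H, restInv H r r' * (if r'.1.1.1 = (x, k) then (1 : ℝ) else 0)) -
          (∑ r' : Rest H, restInv H r r' * (if r'.1.1.1 = (x + Pi.single j 1, k) then (1 : ℝ) else 0))) := by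
      simp only [Matrix.mulVec, dotProduct, landauCoeff_apply, coeffAux, mul_add, mul_sub, Finset.sum_add_distrib, Finset.sum_sub_distrib]
      ring
    rw [hexp]
    exact abs_sub_mul_le_two hw0 (hC H r x j k κ hjk) (hC H r x k j κ (Ne.symm hjk))

end PlaqSource

end Summit.QuantumFields.YangMills.Theorems.AllWindowsColdBoxBoxHighLine

end
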